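import Literature.Computability.AlgebraicComplexity.BorderRankMatMulRectangular
import Literature.Computability.AlgebraicComplexity.BorderRankMatMulSmall223Proofs
import Literature.Computability.AlgebraicComplexity.BorderRankMatMul224
import Literature.Computability.AlgebraicComplexity.BorderRankMatMul225
import Literature.Computability.AlgebraicComplexity.BorderRankMatMul226Glue
import Literature.Computability.AlgebraicComplexity.BorderRankMatMul227Smirnov
import Literature.Computability.AlgebraicComplexity.BorderRankMatMul244Smirnov
import Literature.Computability.AlgebraicComplexity.BorderRankMatMul255Smirnov
import Literature.Computability.AlgebraicComplexity.LandsbergRyderGluing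
import HarnessLib

/-!
# Discharges for `BorderRankMatMulRectangular.lean`: Smirnov's upper bounds `R̲(M_⟨2,2,n⟩) ≤ 3n+1 (n ≤ 7)`, `R̲(M_⟨2,4,4⟩) ≤ 24`, `R̲(M_⟨2,5,5⟩) ≤ 38` are theorems

Topic `Literature/Computability/AlgebraicComplexity`; the `…Proofs` sibling of
`BorderRankMatMulRectangular.lean` (named facts on the border rank of `⟨2,2,n⟩`, `⟨2,n,n⟩`, `⟨3,n,n⟩`
as printed in Conner–Harper–Landsberg 2023 and Landsberg–Ryder 2017).  Three of its named facts are
UPPER bounds due to Smirnov, quoted by CHL 2023 p. 4 ("Smirnov [Smi13] showed that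
`R̲(M_⟨22n⟩) ≤ 3n+1` for `n ≤ 7` […] The upper bound in (1) is due to Smirnov [Smi13], where he also
proved `R̲(M_⟨244⟩) ≤ 24`, and `R̲(M_⟨255⟩) ≤ 38`"); every one of them is now backed by a kernel-checked
approximate decomposition in the tree, so this file DISCHARGES them (`theorem X_holds : X`; the facts
stay `def`s, their users are fed the `_holds` theorems):

* `Smirnov2013_borderRank_matMulTensor_22n_le_holds` — `R̲(M_⟨2,2,n⟩) ≤ 3n + 1` for `1 ≤ n ≤ 7` over
  `ℂ`, by cases: `n = 1` the standard algorithm (`R ≤ 4`, `bR ≤ R`); `n = 2` Strassen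
  (`algBorderRank_matMulTensor_two_le_seven`); `n = 3` Bini–Capovani–Romani–Lotti
  (`BCRL1979_algBorderRank_matMulTensor_223_le`); `n = 4, 5` Bini et al. / Alekseev–Smirnov glued by
  Landsberg–Ryder Prop. 3.1 (`Smirnov2013_borderRank_matMulTensor_22n_le_four / _five`,
  `BorderRankMatMul224/225.lean`); `n = 6` the glued `11 + 8` scheme
  (`Smirnov2013_borderRank_matMulTensor_22n_le_six`, `BorderRankMatMul226Glue.lean`); `n = 7` Smirnov
  2015's `⟨2,7,2; 22⟩` (`Smirnov2013_borderRank_matMulTensor_22n_le_seven`,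
  `BorderRankMatMul227Smirnov.lean`);
* `Smirnov2013_borderRank_matMulTensor_244_le_holds` — `R̲(M_⟨2,4,4⟩) ≤ 24`
  (`Smirnov2013_algBorderRank_matMulTensor_244_le`, `BorderRankMatMul244Smirnov.lean`);
* `Smirnov2013_borderRank_matMulTensor_255_le_holds` — `R̲(M_⟨2,5,5⟩) ≤ 38`, from the STRONGER
  kernel certificate `bR(⟨2,5,5⟩) ≤ 37` (`Smirnov2013_algBorderRank_matMulTensor_255_le_thirtySeven`,
  `BorderRankMatMul255Smirnov.lean`: Smirnov's `⟨5,5,2; 37⟩` as distributed with Benson–Ballard's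
  *fast-matmul*).

* `LandsbergRyder2017_borderRank_matMulTensor_n22_window_holds` — Landsberg–Ryder's summary display
  `3n ≤ R̲(M_⟨n,2,2⟩) ≤ 3n + ⌈n/7⌉` (all `n ≥ 1`, over `ℂ`): the lower half is the Koszul-flattening
  bound `3nm ≤ 2·bR(⟨n,m,n⟩)` of `BorderRankMatMulSmall223Proofs` at `⟨2,n,2⟩` plus rotation
  (`three_mul_le_algBorderRank_matMulTensor_n22`, every field of characteristic `0`); the upper half
  is Smirnov's `n ≤ 7` cases glued along rows of `X` — `bR(⟨a+b,m,n⟩) ≤ bR(⟨a,m,n⟩) + bR(⟨b,m,n⟩)`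
  (`algBorderRank_matMulTensor_rowBlocks_le`, from `algBorderRank_add_le` and zero-extension,
  `LandsbergRyderGluing`) — by induction `n ↦ n + 7` with `bR(⟨7,2,2⟩) ≤ 22`
  (`algBorderRank_matMulTensor_n22_le`).

Also recorded: `Smirnov2013_borderRank_matMulTensor_22n_le_all` — the seven cases as one statement over
`ℂ` in the `3 * n + 1` form, and `LandsbergRyder2017_towerTwoTwo_le_seven` — the unconditional form of
the corollary `Smirnov2013_borderRank_matMulTensor_22n_le.towerTwoTwo` (`bR(⟨2,2,c+1⟩) ≤ 3c + 4`,
`c ≤ 6`).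

## References

* [Smirnov2013] A. V. Smirnov, Comput. Math. Math. Phys. 53 (2013) 1781–1795,
  doi:10.1134/S0965542513120129 — quoted through CHL 2023 p. 4.
* [ConnerHarperLandsberg2023] A. Conner, A. Harper, J. M. Landsberg, Forum Math. Pi 11 (2023) e17 —
  §1 p. 4.
* [LandsbergRyder2015] J. M. Landsberg, N. Ryder, Exp. Math. 26 (2017) 275–286 = arXiv:1509.08323 —
  §3, Prop. 3.1.
* [Smirnov2015] A. V. Smirnov, Comput. Math. Math. Phys. 55 (2015) 541–545 — `⟨2,7,2; 22⟩`.
* [BensonBallard2015] A. R. Benson, G. Ballard, PPoPP 2015 — `fast-matmul`, coefficient files.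
-/

noncomputable section

namespace Literature.Computability.AlgebraicComplexity

/-- `bR(⟨2,2,1⟩) ≤ 4`: the standard algorithm (`R(⟨2,2,1⟩) ≤ 2·2·1`) and `bR ≤ R` — the case
`n = 1` of Smirnov's `3n + 1`. [cite: Blaser2013, §5 and Rem. 6.2] -/
theorem algBorderRank_matMulTensor_221_le_four (K : Type*) [CommRing K] :
    algBorderRank (matMulTensor K 2 2 1) ≤ 4 :=
  (algBorderRank_le_tensorRank _).trans (by simpa using tensorRank_matMulTensor_le (K := K) 2 2 1)

/-- **Smirnov's `R̲(M_⟨2,2,n⟩) ≤ 3n + 1` for `1 ≤ n ≤ 7`, all seven cases, over `ℂ`** (each a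
kernel-checked approximate decomposition in the tree; see the module docstring for the case list).
[cite: Smirnov2013, as quoted in ConnerHarperLandsberg2023 §1 p. 4] [cite: LandsbergRyder2015, §3 Prop. 3.1] -/
theorem Smirnov2013_borderRank_matMulTensor_22n_le_all (n : ℕ) (h1 : 1 ≤ n) (h7 : n ≤ 7) :
    algBorderRank (matMulTensor ℂ 2 2 n) ≤ 3 * n + 1 := by
  interval_cases n
  · simpa using algBorderRank_matMulTensor_221_le_four ℂ
  · simpa using algBorderRank_matMulTensor_two_le_seven ℂ
  · simpa using BCRL1979_algBorderRank_matMulTensor_223_le ℂ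
  · exact Smirnov2013_borderRank_matMulTensor_22n_le_four
  · exact Smirnov2013_borderRank_matMulTensor_22n_le_five
  · exact Smirnov2013_borderRank_matMulTensor_22n_le_six
  · exact Smirnov2013_borderRank_matMulTensor_22n_le_seven

/-- **Discharge of `Smirnov2013_borderRank_matMulTensor_22n_le`** ("Smirnov [Smi13] showed that
`R̲(M_⟨22n⟩) ≤ 3n+1` for `n ≤ 7`", CHL 2023 p. 4): all seven cases are theorems of the tree.
[cite: Smirnov2013, as quoted in ConnerHarperLandsberg2023 §1 p. 4] -/
theorem Smirnov2013_borderRank_matMulTensor_22n_le_holds :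
    Smirnov2013_borderRank_matMulTensor_22n_le :=
  fun n h1 h7 => Smirnov2013_borderRank_matMulTensor_22n_le_all n h1 h7

/-- The corollary `Smirnov2013_borderRank_matMulTensor_22n_le.towerTwoTwo` made unconditional: in the
format of `HollowSchoolbook.TowerTwoTwo`, `bR(⟨2,2,c+1⟩) ≤ 3c + 4` for `c ≤ 6`.
[cite: Smirnov2013, as quoted in ConnerHarperLandsberg2023 §1 p. 4] [cite: LandsbergRyder2015, §3 (p. 5)] -/
theorem LandsbergRyder2017_towerTwoTwo_le_seven (c : ℕ) (hc : c ≤ 6) :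
    algBorderRank (matMulTensor ℂ 2 2 (c + 1)) ≤ 3 * c + 4 :=
  Smirnov2013_borderRank_matMulTensor_22n_le.towerTwoTwo
    Smirnov2013_borderRank_matMulTensor_22n_le_holds c hc

/-- **Discharge of `Smirnov2013_borderRank_matMulTensor_244_le`**: `bR(⟨2,4,4⟩) ≤ 24` over `ℂ`, from
the kernel-checked certificate `Smirnov2013_algBorderRank_matMulTensor_244_le` (every commutative
ring). [cite: Smirnov2013, approximate ⟨4,4,2; 24⟩, as quoted in ConnerHarperLandsberg2023 §1 p. 4] -/
theorem Smirnov2013_borderRank_matMulTensor_244_le_holds :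
    Smirnov2013_borderRank_matMulTensor_244_le :=
  Smirnov2013_algBorderRank_matMulTensor_244_le ℂ

/-- **Discharge of `Smirnov2013_borderRank_matMulTensor_255_le`**: `bR(⟨2,5,5⟩) ≤ 38` over `ℂ`, from
the kernel-checked certificate `Smirnov2013_algBorderRank_matMulTensor_255_le_thirtySeven`
(`bR(⟨2,5,5⟩) ≤ 37`, every commutative ring) and `37 ≤ 38`. [cite: Smirnov2013, approximate
algorithms for ⟨5,5,2⟩, as quoted in ConnerHarperLandsberg2023 §1 p. 4] [cite: BensonBallard2015,
file codegen/algorithms/smirnov255-37-262-approx] -/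
theorem Smirnov2013_borderRank_matMulTensor_255_le_holds :
    Smirnov2013_borderRank_matMulTensor_255_le :=
  (Smirnov2013_algBorderRank_matMulTensor_255_le_thirtySeven ℂ).trans (by norm_num)

/-- With the upper half certified, the printed window for `⟨2,4,4⟩` (CHL 2023 Thm. 1.4(2) at `n = 4`
and Smirnov): `22 ≤ R̲(M_⟨2,4,4⟩) ≤ 24` over `ℂ`, the lower half conditional on the named fact
`ConnerHarperLandsberg2023_thm_1_4_2nn_table`. [cite: ConnerHarperLandsberg2023, Thm. 1.4(2) (arXiv),
n = 4, and §1 p. 4] -/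
theorem algBorderRank_matMulTensor_244_window (h : ConnerHarperLandsberg2023_thm_1_4_2nn_table) :
    22 ≤ algBorderRank (matMulTensor ℂ 2 4 4) ∧ algBorderRank (matMulTensor ℂ 2 4 4) ≤ 24 :=
  ⟨h (4, 22) (by simp), Smirnov2013_borderRank_matMulTensor_244_le_holds⟩

/-! ## Landsberg–Ryder's window `3n ≤ R̲(M_⟨n,2,2⟩) ≤ 3n + ⌈n/7⌉` -/

section RowBlocks

variable (K : Type*) [CommRing K]

/-- Partial row map onto the first `a` rows (of `X` or of `Z = XY`), the column kept.
[cite: Blaser2013, §5 and Thm. 6.3 (sums and restrictions of tensors)] -/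
def rowLo (a b : ℕ) {τ : Type*} (c : Fin (a + b) × τ) : Option (Fin a × τ) :=
  if h : c.1.val < a then some (⟨c.1.val, h⟩, c.2) else none

/-- Partial row map onto the last `b` rows, the column kept.
[cite: Blaser2013, §5 and Thm. 6.3 (sums and restrictions of tensors)] -/
def rowHi (a b : ℕ) {τ : Type*} (c : Fin (a + b) × τ) : Option (Fin b × τ) :=
  if h : a ≤ c.1.val then some (⟨c.1.val - a, by omega⟩, c.2) else none

/-- Closed form of the first row block of `⟨a+b,m,n⟩` at a point. [cite: Blaser2013, §5] -/
private theorem rowBlockLo_apply (a b m n : ℕ) (I I' : Fin (a + b)) (u u' : Fin n) (α α' : Fin m) :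
    optPullTensor (matMulTensor K a m n) (rowLo a b) (rowLo a b) some (I, u) (I', α) (α', u') =
      if (I : ℕ) < a ∧ (I' : ℕ) < a then
        (if (I : ℕ) = (I' : ℕ) ∧ α = α' ∧ u = u' then 1 else 0) else 0 := by
  unfold optPullTensor rowLo matMulTensor
  by_cases h1 : (I : ℕ) < a <;> by_cases h2 : (I' : ℕ) < a <;> simp [h1, h2]

/-- Closed form of the second row block of `⟨a+b,m,n⟩` at a point. [cite: Blaser2013, §5] -/
private theorem rowBlockHi_apply (a b m n : ℕ) (I I' : Fin (a + b)) (u u' : Fin n) (α α' : Fin m) :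
    optPullTensor (matMulTensor K b m n) (rowHi a b) (rowHi a b) some (I, u) (I', α) (α', u') =
      if a ≤ (I : ℕ) ∧ a ≤ (I' : ℕ) then
        (if (I : ℕ) - a = (I' : ℕ) - a ∧ α = α' ∧ u = u' then 1 else 0) else 0 := by
  unfold optPullTensor rowHi matMulTensor
  by_cases h1 : a ≤ (I : ℕ) <;> by_cases h2 : a ≤ (I' : ℕ) <;> simp [h1, h2]

/-- **Row-block identity**: `⟨a+b,m,n⟩` is the sum of `⟨a,m,n⟩` on the first `a` rows of `X` and `XY`
and `⟨b,m,n⟩` on the last `b` rows, each zero-extended (the direct sum `⟨a,m,n⟩ ⊕ ⟨b,m,n⟩` with the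
two copies of `Y` identified). [cite: Blaser2013, §5 and Thm. 6.3] -/
theorem matMulTensor_eq_rowBlocks (a b m n : ℕ) :
    matMulTensor K (a + b) m n =
      optPullTensor (matMulTensor K a m n) (rowLo a b) (rowLo a b) some +
        optPullTensor (matMulTensor K b m n) (rowHi a b) (rowHi a b) some := by
  funext c x y
  obtain ⟨I, u⟩ := c
  obtain ⟨I', α⟩ := x
  obtain ⟨α', u'⟩ := y
  have hI := I.isLt
  have hI' := I'.isLt
  have e : (I = I') ↔ ((I : ℕ) = (I' : ℕ)) := Fin.ext_iff
  simp only [Pi.add_apply, rowBlockLo_apply, rowBlockHi_apply, matMulTensor, e]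
  by_cases hα : α = α'
  · by_cases hu : u = u'
    · simp [hα, hu]
      split_ifs <;> first | (simp; done) | (exfalso; omega)
    · simp [hα, hu]
  · simp [hα]

/-- **Border rank is subadditive along row blocks**: `bR(⟨a+b,m,n⟩) ≤ bR(⟨a,m,n⟩) + bR(⟨b,m,n⟩)`
over every commutative ring (`bR(t + t') ≤ bR(t) + bR(t')` and monotonicity under zero-extension).
[cite: Blaser2013, Thm. 6.3] [cite: LandsbergRyder2015, §3 (the display after Prop. 3.1)] -/
theorem algBorderRank_matMulTensor_rowBlocks_le (a b m n : ℕ) :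
    algBorderRank (matMulTensor K (a + b) m n) ≤
      algBorderRank (matMulTensor K a m n) + algBorderRank (matMulTensor K b m n) := by
  rw [matMulTensor_eq_rowBlocks K a b m n]
  exact (algBorderRank_add_le _ _).trans
    (Nat.add_le_add (algBorderRank_optPull_le _ _ _ _) (algBorderRank_optPull_le _ _ _ _))

end RowBlocks

/-- **`3n ≤ bR(⟨n,2,2⟩)`** over a field of characteristic `0` ("Strassen's equations imply
`R̲(M_⟨n,2,2⟩) ≥ 3n`", Landsberg–Ryder §3; here from the Koszul-flattening bound
`3·2·n ≤ 2·bR(⟨2,n,2⟩)` and `bR(⟨n,2,2⟩) = bR(⟨2,2,n⟩) = bR(⟨2,n,2⟩)`).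
[cite: LandsbergRyder2015, §3 (display before the summary)] [cite: LandsbergOttaviani2015, Thm 2.1] -/
theorem three_mul_le_algBorderRank_matMulTensor_n22 (K : Type*) [Field K] [CharZero K] (n : ℕ) :
    3 * n ≤ algBorderRank (matMulTensor K n 2 2) := by
  have h := three_mul_mul_le_two_mul_algBorderRank_matMulTensor K 2 n le_rfl
  rw [algBorderRank_matMulTensor_rotate K n 2 2, algBorderRank_matMulTensor_rotate K 2 2 n]
  omega

/-- **`bR(⟨n,2,2⟩) ≤ 3n + ⌈n/7⌉`** over `ℂ` for `n ≥ 1` (`⌈n/7⌉ = (n+6)/7`): Smirnov's `bR(⟨2,2,n⟩) ≤ 3n+1`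
for `n ≤ 7` and, for `n ≥ 8`, `bR(⟨n,2,2⟩) ≤ bR(⟨n−7,2,2⟩) + bR(⟨7,2,2⟩) ≤ 3(n−7) + ⌈(n−7)/7⌉ + 22`.
[cite: LandsbergRyder2015, §3 (summary display: upper bounds from BCLR79, AlSmir, Smirnov)] -/
theorem algBorderRank_matMulTensor_n22_le (n : ℕ) (hn : 1 ≤ n) :
    algBorderRank (matMulTensor ℂ n 2 2) ≤ 3 * n + (n + 6) / 7 := by
  induction n using Nat.strong_induction_on with
  | _ n ih =>
    by_cases h7 : n ≤ 7
    · have h := Smirnov2013_borderRank_matMulTensor_22n_le_all n hn h7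
      rw [algBorderRank_matMulTensor_rotate ℂ n 2 2]
      omega
    · obtain ⟨k, rfl⟩ : ∃ k, n = k + 7 := ⟨n - 7, by omega⟩
      have ih' := ih k (by omega) (by omega)
      have h7' := Smirnov2013_borderRank_matMulTensor_22n_le_all 7 (by norm_num) le_rfl
      rw [← algBorderRank_matMulTensor_rotate ℂ 7 2 2] at h7'
      have hadd := algBorderRank_matMulTensor_rowBlocks_le ℂ k 7 2 2
      omega

/-- **Discharge of `LandsbergRyder2017_borderRank_matMulTensor_n22_window`** (Landsberg–Ryder 2017, §3
summary display `3n ≤ R̲(M_⟨n,2,2⟩) ≤ 3n + ⌈n/7⌉`, all `n ≥ 1`, over `ℂ`).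
[cite: LandsbergRyder2015, §3, Prop. 3.1–3.2 and the summary display (p. 5)] -/
theorem LandsbergRyder2017_borderRank_matMulTensor_n22_window_holds :
    LandsbergRyder2017_borderRank_matMulTensor_n22_window := fun n hn =>
  ⟨three_mul_le_algBorderRank_matMulTensor_n22 ℂ n, algBorderRank_matMulTensor_n22_le n hn⟩

end Literature.Computability.AlgebraicComplexity

end
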